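import Summits.Parity.GeneralizedHardyLittlewood.Theorems.LeeYangFibresFibreHyperbolicityAlongDefs
import Summits.Parity.GeneralizedHardyLittlewood.Theorems.LeeYangFibresAbsoluteUpgradeClipCellsAux
import Summits.Parity.GeneralizedHardyLittlewood.Theorems.LeeYangFibresAbsoluteUpgradeAnatomyAlong
import Summits.Parity.GeneralizedHardyLittlewood.Theorems.LeeYangFibresAbsoluteUpgradeQuantClipNumerics
import Summits.Parity.GeneralizedHardyLittlewood.Theorems.LeeYangFibresHyperbolicityClipsParityPrep
import HarnessLib

/-!
# Crux `FibreHyperbolicityAlong` (stmt-Parity-18103), line `sifted-chowla-distillation`: stub `stub_ghostFreeAlong`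

`CellParityLawSaving → SiftedSinglesAlong → SiftedChowlaMixedAlong → GhostFreeLawAlong` (pure Walsh inversion).  At scale
`N`, `U = slowDegree N`, `a_m = A_m(N)/N` (`A_m = Negative.cell U N m`), `Â = Σ_m a_m`, `Ã = Σ_m (-1)^m a_m`, `MS = β_∞𝔖`:
(§1) for EVERY sign set `S`, `|θ_S| Â^t ≤ |Σ_{j∈[1,U]^t} (∏_{k∈S}(-1)^{j_k}) Θ_θ(j) ∏_k a_{j_k}| + 2^{t+1}|Ã| Â^{t-1}`,
reduced to the tree's singleton case `abs_theta_singleton_mul_pow_le` by the Walsh twist `θ ↦ θ(S ∆ ·)`;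
(§2) `Σ_j (∏_{k∈S}(-1)^{j_k}) C_j = siftedLiouvilleCorr … S` exactly once `N^{1/U} ≥ 2L + 2` (`cellIndex_mem_piFinset`),
and `Σ_m (-1)^m A_m(N)` is the `t = 1` correlation of the identity form on `[-N, N]` (`sum_roughTuples_idForm`);
(§3) numerics: singles/mixed at `C₁ = C + t + log K`, `K = 12·4^t(1 + 1/η)`, `Â ≥ a_1 ≥ 1/(2 log N)` (`AnatomyAlong`,
`m = 1`), `|Ã| ≤ e^{-C₁U} U/log N`, `(log N)^{-δ} ≤ e^{-4δU²}` (`quantClip_schedule`) give `|θ_S| ≤ e^{-CU}/2^t`, `S ≠ ∅`.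
-/
noncomputable section

namespace Summit.Parity.GeneralizedHardyLittlewood.Cruxes.FibreHyperbolicityAlong.SiftedChowlaDistillation

open scoped BigOperators Classical
open Finset
open Literature.NumberTheory.Sieve
open Summit.Parity.GeneralizedHardyLittlewood.Theses.LeeYangFibres (CellParityLawSaving)
open Summit.Parity.GeneralizedHardyLittlewood.Cruxes.AbsoluteUpgrade.DipMarginRateExchange (slowDegree
  four_le_slowDegree stub_anatomyAlong quantClip_schedule)
open Summit.Parity.GeneralizedHardyLittlewood.Cruxes.ModelHyperbolicity.WindowChainTransport (cellDensity cellDensity_zero)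
open Summit.Parity.GeneralizedHardyLittlewood.Cruxes.FibreHyperbolicity.ModelTransfer (jointCell)
open Summit.Parity.GeneralizedHardyLittlewood.Cruxes.AbsoluteUpgrade.NlcCellsAbsoluteClip (roughTuples walshForm)
open Summit.Parity.GeneralizedHardyLittlewood.Theorems.ModelHyperbolicity.Negative (cell)
open Summit.Parity.GeneralizedHardyLittlewood.Theorems.AbsoluteUpgrade (abs_theta_singleton_mul_pow_le
  cellIndex_mem_piFinset jointCell_eq_card_filter sum_roughTuples_idForm)

variable {t : ℕ}

/-- `(-1)^n (-1)^n = 1`. -/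
private theorem neg_one_pow_mul_self (n : ℕ) : (-1 : ℝ) ^ n * (-1) ^ n = 1 := by
  rw [← pow_add, ← two_mul, pow_mul]; simp

/-- Signs multiply over the symmetric difference: `∏_A s · ∏_B s = ∏_{A ∆ B} s` when `s_i² = 1`. -/
private theorem prod_mul_prod_eq_prod_symmDiff {ι : Type*} [DecidableEq ι] (A B : Finset ι) (s : ι → ℝ)
    (hs : ∀ i, s i * s i = 1) : (∏ i ∈ A, s i) * ∏ i ∈ B, s i = ∏ i ∈ symmDiff A B, s i := by
  have h1 : (∏ i ∈ A ∪ B, s i) * ∏ i ∈ A ∩ B, s i = (∏ i ∈ A, s i) * ∏ i ∈ B, s i := prod_union_inter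
  have h2 : A ∪ B = symmDiff A B ∪ A ∩ B := (symmDiff_sup_inf A B).symm
  have h4 : (∏ i ∈ A ∩ B, s i) * ∏ i ∈ A ∩ B, s i = 1 := by rw [← prod_mul_distrib]; exact prod_eq_one fun i _ => hs i
  rw [← h1, h2, prod_union (show Disjoint (symmDiff A B) (A ∩ B) from disjoint_symmDiff_inf A B), mul_assoc, h4, mul_one]

/-- Walsh twist (§1): `(∏_{k∈S} (-1)^{j_k}) Θ_θ(j) = (-1)^{|S|} Θ_{θ(S ∆ ·)}(j)` (`χ_S χ_T = χ_{S ∆ T}`; `T ↦ S ∆ T` is an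
involution of the sign sets). -/
private theorem sign_mul_walshForm (θ : Finset (Fin t) → ℝ) (S : Finset (Fin t)) (j : Fin t → ℕ) :
    (∏ k ∈ S, (-1 : ℝ) ^ (j k)) * walshForm θ j = (-1) ^ S.card * walshForm (fun T => θ (symmDiff S T)) j := by
  have hS : ∏ k ∈ S, (-1 : ℝ) ^ (j k) = (-1) ^ S.card * ∏ k ∈ S, (-1 : ℝ) ^ (j k + 1) := by
    rw [← prod_const, ← prod_mul_distrib]; exact prod_congr rfl fun k _ => by ring
  rw [hS, mul_assoc]; refine congrArg ((-1 : ℝ) ^ S.card * ·) ?_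
  unfold walshForm; rw [mul_sum]
  refine Fintype.sum_bijective (fun T => symmDiff S T) (symmDiff_right_involutive S).bijective _ _ fun T => ?_
  dsimp only; rw [symmDiff_symmDiff_cancel_left, ← prod_mul_prod_eq_prod_symmDiff S T _ fun k => neg_one_pow_mul_self _]; ring

/-- The marginal Walsh bound for EVERY sign set `S` (the tree's `abs_theta_singleton_mul_pow_le` is `S = {i}`), by the
twist `φ = θ((S ∆ {i}) ∆ ·)`: `φ_{{i}} = θ_S` and `(-1)^{j_i} Θ_φ(j) = ∓(∏_{k∈S} (-1)^{j_k}) Θ_θ(j)`. -/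
private theorem abs_theta_mul_pow_le (θ : Finset (Fin t) → ℝ) (hθ : ∀ S, |θ S| ≤ 2) (a : ℕ → ℝ)
    (ha : ∀ m, 0 ≤ a m) (u : ℕ) (i : Fin t) (S : Finset (Fin t)) :
    |θ S| * (∑ m ∈ Icc 1 u, a m) ^ t ≤
      |∑ j ∈ Fintype.piFinset (fun _ : Fin t => Icc 1 u), (∏ k ∈ S, (-1 : ℝ) ^ (j k)) * (walshForm θ j * ∏ k, a (j k))| +
        2 ^ (t + 1) * |∑ m ∈ Icc 1 u, (-1 : ℝ) ^ m * a m| * (∑ m ∈ Icc 1 u, a m) ^ (t - 1) := by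
  obtain ⟨φ, hφ⟩ : ∃ φ : Finset (Fin t) → ℝ, ∀ T, φ T = θ (symmDiff (symmDiff S {i}) T) := ⟨_, fun _ => rfl⟩
  have key := abs_theta_singleton_mul_pow_le φ (fun T => by rw [hφ]; exact hθ _) a ha u i
  have hφi : φ {i} = θ S := by rw [hφ, symmDiff_symmDiff_cancel_right]
  have hterm : ∀ j : Fin t → ℕ, (-1 : ℝ) ^ (j i) * (walshForm φ j * ∏ k, a (j k)) =
      -(-1) ^ S.card * ((∏ k ∈ S, (-1 : ℝ) ^ (j k)) * (walshForm θ j * ∏ k, a (j k))) := by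
    intro j
    have h1 := sign_mul_walshForm φ {i} j
    have h3 : (fun T => φ (symmDiff {i} T)) = fun T => θ (symmDiff S T) := by
      funext T; rw [hφ, symmDiff_assoc, symmDiff_symmDiff_cancel_left]
    have h4 : walshForm (fun T => θ (symmDiff S T)) j = (-1) ^ S.card * ((∏ k ∈ S, (-1 : ℝ) ^ (j k)) * walshForm θ j) := by
      rw [sign_mul_walshForm θ S j, ← mul_assoc, neg_one_pow_mul_self, one_mul]
    rw [prod_singleton, card_singleton, pow_one, h3, h4] at h1
    calc (-1 : ℝ) ^ (j i) * (walshForm φ j * ∏ k, a (j k)) = ((-1 : ℝ) ^ (j i) * walshForm φ j) * ∏ k, a (j k) := by ring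
      _ = _ := by rw [h1]; ring
  have hsum : ∑ j ∈ Fintype.piFinset (fun _ : Fin t => Icc 1 u), (-1 : ℝ) ^ (j i) * (walshForm φ j * ∏ k, a (j k)) =
      -(-1) ^ S.card * ∑ j ∈ Fintype.piFinset (fun _ : Fin t => Icc 1 u),
        (∏ k ∈ S, (-1 : ℝ) ^ (j k)) * (walshForm θ j * ∏ k, a (j k)) := by
    rw [mul_sum]; exact sum_congr rfl fun j _ => hterm j
  rwa [hφi, hsum, abs_mul, abs_neg, abs_pow, abs_neg, abs_one, one_pow, one_mul] at key

/-- `|∏_{k∈S} (-1)^{j_k}| = 1`. -/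
private theorem abs_prod_sign (S : Finset (Fin t)) (j : Fin t → ℕ) : |∏ k ∈ S, (-1 : ℝ) ^ (j k)| = 1 := by
  rw [prod_pow_eq_pow_sum, abs_neg_one_pow]

/-- **Amplitudes at one scale, every sign set** (the tree's `abs_theta_singleton_le` for general `S`).  If the
cells obey `|C_j − Θ_θ(j) M ∏_k a_{j_k}| ≤ e₁` on `[1,u]^t` (`a ≥ 0`, `M > 0`, `Â > 0`) and
`|Σ_j (∏_{k∈S}(-1)^{j_k}) C_j| ≤ X`, then `|θ_S| ≤ (X + u^t e₁)/(M Â^t) + 2^{t+1} |Ã|/Â`. -/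
private theorem abs_theta_le (θ : Finset (Fin t) → ℝ) (hθ2 : ∀ S, |θ S| ≤ 2) (C : (Fin t → ℕ) → ℝ) {M : ℝ}
    (hM : 0 < M) (a : ℕ → ℝ) (ha : ∀ m, 0 ≤ a m) {u : ℕ} (hA : 0 < ∑ m ∈ Icc 1 u, a m) {e₁ X : ℝ}
    (i : Fin t) (S : Finset (Fin t))
    (hlaw : ∀ j ∈ Fintype.piFinset (fun _ : Fin t => Icc 1 u), |C j - walshForm θ j * (M * ∏ k, a (j k))| ≤ e₁)
    (hX : |∑ j ∈ Fintype.piFinset (fun _ : Fin t => Icc 1 u), (∏ k ∈ S, (-1 : ℝ) ^ (j k)) * C j| ≤ X) :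
    |θ S| ≤ (X + (u : ℝ) ^ t * e₁) / (M * (∑ m ∈ Icc 1 u, a m) ^ t) +
      2 ^ (t + 1) * |∑ m ∈ Icc 1 u, (-1 : ℝ) ^ m * a m| / ∑ m ∈ Icc 1 u, a m := by
  -- adapted from `Theorems.AbsoluteUpgrade.abs_theta_singleton_le` (…ClipCellsAux), sign `∏_{k∈S}(-1)^{j_k}`
  set A := ∑ m ∈ Icc 1 u, a m with hAdef
  set P := Fintype.piFinset (fun _ : Fin t => Icc 1 u) with hP
  have ht : 0 < t := i.pos
  have hAt : 0 < A ^ t := pow_pos hA t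
  have h1 : |∑ j ∈ P, (∏ k ∈ S, (-1 : ℝ) ^ (j k)) * (walshForm θ j * ∏ k, a (j k))| ≤ (X + (u : ℝ) ^ t * e₁) / M := by
    rw [le_div_iff₀ hM]
    have hdecomp : (∑ j ∈ P, (∏ k ∈ S, (-1 : ℝ) ^ (j k)) * (walshForm θ j * ∏ k, a (j k))) * M =
        ∑ j ∈ P, (∏ k ∈ S, (-1 : ℝ) ^ (j k)) * C j -
          ∑ j ∈ P, (∏ k ∈ S, (-1 : ℝ) ^ (j k)) * (C j - walshForm θ j * (M * ∏ k, a (j k))) := by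
      rw [← sum_sub_distrib, sum_mul]; exact sum_congr rfl fun j _ => by ring
    have hE : |∑ j ∈ P, (∏ k ∈ S, (-1 : ℝ) ^ (j k)) * (C j - walshForm θ j * (M * ∏ k, a (j k)))| ≤ (u : ℝ) ^ t * e₁ :=
      calc |∑ j ∈ P, (∏ k ∈ S, (-1 : ℝ) ^ (j k)) * (C j - walshForm θ j * (M * ∏ k, a (j k)))|
          ≤ ∑ j ∈ P, |(∏ k ∈ S, (-1 : ℝ) ^ (j k)) * (C j - walshForm θ j * (M * ∏ k, a (j k)))| :=
            abs_sum_le_sum_abs _ _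
        _ ≤ ∑ _j ∈ P, e₁ := sum_le_sum fun j hj => by rw [abs_mul, abs_prod_sign, one_mul]; exact hlaw j hj
        _ = (u : ℝ) ^ t * e₁ := by
            rw [sum_const, nsmul_eq_mul, hP, Fintype.card_piFinset_const, Nat.card_Icc, Nat.add_sub_cancel]
            push_cast; ring
    calc |∑ j ∈ P, (∏ k ∈ S, (-1 : ℝ) ^ (j k)) * (walshForm θ j * ∏ k, a (j k))| * M
        = |(∑ j ∈ P, (∏ k ∈ S, (-1 : ℝ) ^ (j k)) * (walshForm θ j * ∏ k, a (j k))) * M| := by rw [abs_mul, abs_of_pos hM]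
      _ ≤ |∑ j ∈ P, (∏ k ∈ S, (-1 : ℝ) ^ (j k)) * C j| +
            |∑ j ∈ P, (∏ k ∈ S, (-1 : ℝ) ^ (j k)) * (C j - walshForm θ j * (M * ∏ k, a (j k)))| := by
          rw [hdecomp]; exact abs_sub _ _
      _ ≤ X + (u : ℝ) ^ t * e₁ := add_le_add hX hE
  have hpow : A ^ t = A ^ (t - 1) * A := by rw [← pow_succ, Nat.sub_add_cancel ht]
  calc |θ S| ≤ (|∑ j ∈ P, (∏ k ∈ S, (-1 : ℝ) ^ (j k)) * (walshForm θ j * ∏ k, a (j k))| +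
          2 ^ (t + 1) * |∑ m ∈ Icc 1 u, (-1 : ℝ) ^ m * a m| * A ^ (t - 1)) / A ^ t :=
        (le_div_iff₀ hAt).mpr (abs_theta_mul_pow_le θ hθ2 a ha u i S)
    _ = |∑ j ∈ P, (∏ k ∈ S, (-1 : ℝ) ^ (j k)) * (walshForm θ j * ∏ k, a (j k))| / A ^ t +
          2 ^ (t + 1) * |∑ m ∈ Icc 1 u, (-1 : ℝ) ^ m * a m| / A := by
        rw [add_div, hpow, mul_comm (A ^ (t - 1)) A, mul_div_mul_right _ _ (pow_pos hA _).ne']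
    _ ≤ (X + (u : ℝ) ^ t * e₁) / M / A ^ t + 2 ^ (t + 1) * |∑ m ∈ Icc 1 u, (-1 : ℝ) ^ m * a m| / A := by gcongr
    _ = _ := by rw [div_div]

/-- `|Θ_θ(j) − 1| ≤ ε` as soon as `θ_∅ = 1` and `|θ_S| ≤ ε/2^t` for `S ≠ ∅`. -/
private theorem abs_walshForm_sub_one_le (θ : Finset (Fin t) → ℝ) (hθ0 : θ ∅ = 1) {ε : ℝ} (hε : 0 ≤ ε)
    (hθ : ∀ S, S ≠ ∅ → |θ S| ≤ ε / 2 ^ t) (j : Fin t → ℕ) : |walshForm θ j - 1| ≤ ε := by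
  unfold walshForm
  rw [← add_sum_erase univ _ (mem_univ (∅ : Finset (Fin t))), hθ0, prod_empty, one_mul, add_sub_cancel_left]
  calc |∑ S ∈ univ.erase ∅, θ S * ∏ i ∈ S, (-1 : ℝ) ^ (j i + 1)|
      ≤ ∑ S ∈ univ.erase ∅, |θ S * ∏ i ∈ S, (-1 : ℝ) ^ (j i + 1)| := abs_sum_le_sum_abs _ _
    _ ≤ ∑ S ∈ univ.erase ∅, ε / 2 ^ t := sum_le_sum fun S hS => by
        rw [abs_mul, prod_pow_eq_pow_sum, abs_neg_one_pow, mul_one]; exact hθ S (ne_of_mem_erase hS)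
    _ ≤ ∑ _S : Finset (Fin t), ε / 2 ^ t := sum_le_sum_of_subset_of_nonneg (erase_subset _ _) fun _ _ _ => by positivity
    _ = ε := by rw [sum_const, card_univ, Fintype.card_finset, Fintype.card_fin, nsmul_eq_mul]; push_cast; field_simp

/-- **Exact identity (§2).** Once `N^{1/u} ≥ max(2, 2L)` the rough tuples are the disjoint union of the joint cells `C_j`,
`j ∈ [1,u]^t`, so `Σ_j (∏_{k∈S} (-1)^{j_k}) C_j = Σ_{rough tuples} ∏_{k∈S} λ(ψ_k(n))`. -/
private theorem sum_sign_jointCell_eq_corr (Ψ : Fin t → AffLinForm 1) (K : Set (Fin 1 → ℝ)) {N u L : ℕ}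
    (hN : 1 ≤ N) (hu : 1 ≤ u) (hL : affLinSize Ψ N ≤ L) (hz2 : (2 : ℝ) ≤ (N : ℝ) ^ ((1 : ℝ) / u))
    (hzL : (2 * L : ℝ) ≤ (N : ℝ) ^ ((1 : ℝ) / u)) (S : Finset (Fin t)) :
    ∑ j ∈ Fintype.piFinset (fun _ : Fin t => Icc 1 u), (∏ k ∈ S, (-1 : ℝ) ^ (j k)) * (jointCell t N u Ψ K j : ℝ) =
      (siftedLiouvilleCorr t N u Ψ K S : ℝ) := by
  -- adapted from `Theorems.AbsoluteUpgrade.sum_roughTuples_sign_eq_sum_cells` (…ClipCellsWalsh)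
  have hmaps : ∀ n ∈ roughTuples Ψ K N u, (fun k => ArithmeticFunction.cardFactors ((Ψ k).eval n).toNat) ∈
      Fintype.piFinset (fun _ : Fin t => Icc 1 u) := fun n hn => cellIndex_mem_piFinset Ψ K hN hu hL hz2 hzL hn
  rw [siftedLiouvilleCorr]
  push_cast
  rw [← sum_fiberwise_of_maps_to' hmaps (fun j : Fin t → ℕ => ∏ k ∈ S, (-1 : ℝ) ^ (j k))]
  refine sum_congr rfl fun j _ => ?_
  rw [sum_const, nsmul_eq_mul, jointCell_eq_nlc, jointCell_eq_card_filter, mul_comm]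

/-- The alternating model-cell sum is the `t = 1` correlation of the identity form on `[-N, N]`:
`Σ_{m ≤ u} (-1)^m A_m(N) = siftedLiouvilleCorr 1 N u (n) [-N,N] {0}` (for `N^{1/u} ≥ 2`). -/
private theorem altSum_cell_eq_corr {N u : ℕ} (hN : 1 ≤ N) (hu : 1 ≤ u) (hz2 : (2 : ℝ) ≤ (N : ℝ) ^ ((1 : ℝ) / u)) :
    ∑ m ∈ Icc 1 u, (-1 : ℝ) ^ m * (cell u N m : ℝ) = (siftedLiouvilleCorr 1 N u idForm (realBox 1 N) {0} : ℝ) := by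
  rw [siftedLiouvilleCorr]
  push_cast
  simp_rw [prod_singleton]
  rw [sum_roughTuples_idForm hN hu hz2]
  rfl

/-- The constant `K = 12 · 4^t (1 + 1/η) ≥ 12` (§3). -/
private theorem twelve_le_K {η : ℝ} (hη : 0 < η) : (12 : ℝ) ≤ 12 * 2 ^ t * 2 ^ t * (1 + η⁻¹) := by
  have hP : (1 : ℝ) ≤ 2 ^ t := one_le_pow₀ (by norm_num)
  nlinarith [one_le_mul_of_one_le_of_one_le hP hP, inv_nonneg.mpr hη.le]

/-- Bookkeeping at one scale (§3): with `MS ≥ ηN`, `Â ≥ 1/(2 log N)`, `|Ã| ≤ e U/log N`, the bound `(X + U^t E₀)/(MS Â^t)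
+ 2^{t+1}|Ã|/Â` (`X = e N U^t/log^t N`, `E₀ = N/(log^t N · D)`) is at most `(2U)^t e/η + (2U)^t/(η D) + 2^{t+2} U e`. -/
private theorem theta_bound_arith {U lN η Nr MS Ap Ama e D θa : ℝ} (hη : 0 < η) (hN : 0 < Nr) (hlN : 0 < lN)
    (hD : 0 < D) (he : 0 ≤ e) (hU : 0 ≤ U) (hMS : η * Nr ≤ MS) (hAp : 1 / (2 * lN) ≤ Ap) (hAm : Ama ≤ e * U / lN)
    (hθ : θa ≤ (e * Nr * U ^ t / lN ^ t + U ^ t * (Nr / (lN ^ t * D))) / (MS * Ap ^ t) + 2 ^ (t + 1) * Ama / Ap) :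
    θa ≤ (2 * U) ^ t / η * e + (2 * U) ^ t / η * D⁻¹ + 2 ^ (t + 2) * U * e := by
  have hMS0 : 0 < MS := lt_of_lt_of_le (mul_pos hη hN) hMS
  have hAp0 : 0 < Ap := lt_of_lt_of_le (by positivity) hAp
  have hnum : 0 ≤ e * Nr * U ^ t / lN ^ t + U ^ t * (Nr / (lN ^ t * D)) := by positivity
  have h1 : (e * Nr * U ^ t / lN ^ t + U ^ t * (Nr / (lN ^ t * D))) / (MS * Ap ^ t) ≤
      (e * Nr * U ^ t / lN ^ t + U ^ t * (Nr / (lN ^ t * D))) / (η * Nr * (1 / (2 * lN)) ^ t) :=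
    div_le_div_of_nonneg_left hnum (by positivity)
      (mul_le_mul hMS (pow_le_pow_left₀ (by positivity) hAp t) (by positivity) hMS0.le)
  have h1' : (e * Nr * U ^ t / lN ^ t + U ^ t * (Nr / (lN ^ t * D))) / (η * Nr * (1 / (2 * lN)) ^ t) =
      (2 * U) ^ t / η * e + (2 * U) ^ t / η * D⁻¹ := by
    rw [mul_pow, div_pow, one_pow, mul_pow]; field_simp
  have h2 : 2 ^ (t + 1) * Ama / Ap ≤ 2 ^ (t + 1) * (e * U / lN) / (1 / (2 * lN)) := by gcongr
  have h2' : 2 ^ (t + 1) * (e * U / lN) / (1 / (2 * lN)) = 2 ^ (t + 2) * U * e := by field_simp; ring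
  linarith

/-- The three numerical terms against `e^{-CU}/2^t`, for `C₁ = C + t + log K`, `K = 12·4^t(1 + 1/η)`,
`log K + (t + C) U ≤ 4δU²` and `e^{4δU²} ≤ D` (`= (log N)^δ`): each carries a factor `K⁻¹ e^{-CU}`. -/
private theorem numerics (ht : 1 ≤ t) {η δ C U D K C₁ : ℝ} (hη : 0 < η) (hU : 1 ≤ U)
    (hK : K = 12 * 2 ^ t * 2 ^ t * (1 + η⁻¹)) (hC₁ : C₁ = C + t + Real.log K)
    (hKU : Real.log K + (t + C) * U ≤ 4 * δ * U ^ 2) (hD : Real.exp (4 * δ * U ^ 2) ≤ D) :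
    (2 * U) ^ t / η * Real.exp (-(C₁ * U)) + (2 * U) ^ t / η * D⁻¹ + 2 ^ (t + 2) * U * Real.exp (-(C₁ * U)) ≤
      Real.exp (-(C * U)) / 2 ^ t := by
  have hK12 : (12 : ℝ) ≤ K := hK ▸ twelve_le_K hη
  have hK0 : 0 < K := by linarith
  have hlogK : 0 ≤ Real.log K := Real.log_nonneg (by linarith)
  have hU0 : 0 ≤ U := by linarith
  have hUe : U ≤ Real.exp U := by linarith [Real.add_one_le_exp U]
  have hUt : U ^ t ≤ Real.exp (t * U) := by rw [Real.exp_nat_mul]; exact pow_le_pow_left₀ hU0 hUe t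
  have hKinv : K⁻¹ = Real.exp (-Real.log K) := by rw [Real.exp_neg, Real.exp_log hK0]
  have hlogKU : Real.log K ≤ Real.log K * U := le_mul_of_one_le_right hlogK hU
  obtain ⟨E, hE⟩ : ∃ E : ℝ, E = Real.exp (-(C * U)) := ⟨_, rfl⟩
  have hE0 : 0 < E := hE ▸ Real.exp_pos _
  rw [← hE]
  -- first term
  have hT1 : (2 * U) ^ t / η * Real.exp (-(C₁ * U)) ≤ 2 ^ t / η * K⁻¹ * E := by
    have h1 : Real.exp (-(C₁ * U)) = E * (Real.exp (-(t * U)) * Real.exp (-(Real.log K * U))) := by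
      rw [hE, ← Real.exp_add, ← Real.exp_add, hC₁]; congr 1; ring
    have h2 : (2 * U) ^ t * Real.exp (-(t * U)) ≤ 2 ^ t := by
      rw [mul_pow]
      calc (2 : ℝ) ^ t * U ^ t * Real.exp (-(t * U)) ≤ 2 ^ t * Real.exp (t * U) * Real.exp (-(t * U)) := by gcongr
        _ = 2 ^ t := by rw [mul_assoc, ← Real.exp_add, add_neg_cancel, Real.exp_zero, mul_one]
    have h3 : Real.exp (-(Real.log K * U)) ≤ K⁻¹ := by rw [hKinv, Real.exp_le_exp]; linarith
    calc (2 * U) ^ t / η * Real.exp (-(C₁ * U))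
        = ((2 * U) ^ t * Real.exp (-(t * U))) * Real.exp (-(Real.log K * U)) / η * E := by rw [h1]; ring
      _ ≤ 2 ^ t * K⁻¹ / η * E := by gcongr
      _ = 2 ^ t / η * K⁻¹ * E := by ring
  -- second term
  have hT2 : (2 * U) ^ t / η * D⁻¹ ≤ 2 ^ t / η * K⁻¹ * E := by
    have hD0 : 0 < D := lt_of_lt_of_le (Real.exp_pos _) hD
    have h1 : D⁻¹ ≤ Real.exp (-(4 * δ * U ^ 2)) := by rw [Real.exp_neg]; exact inv_anti₀ (Real.exp_pos _) hD
    have h2 : K * Real.exp ((t + C) * U) ≤ Real.exp (4 * δ * U ^ 2) := by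
      simpa only [Real.exp_add, Real.exp_log hK0] using Real.exp_le_exp.mpr hKU
    have h3 : Real.exp ((t + C) * U) * Real.exp (-(4 * δ * U ^ 2)) ≤ K⁻¹ := by
      rw [Real.exp_neg, ← div_eq_mul_inv, div_le_iff₀ (Real.exp_pos _), inv_mul_eq_div, le_div_iff₀ hK0]
      linarith
    have h4 : Real.exp (t * U) = Real.exp ((t + C) * U) * E := by rw [hE, ← Real.exp_add]; congr 1; ring
    calc (2 * U) ^ t / η * D⁻¹ ≤ 2 ^ t * Real.exp (t * U) / η * Real.exp (-(4 * δ * U ^ 2)) := by rw [mul_pow]; gcongr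
      _ = 2 ^ t / η * (Real.exp ((t + C) * U) * Real.exp (-(4 * δ * U ^ 2))) * E := by rw [h4]; ring
      _ ≤ 2 ^ t / η * K⁻¹ * E := by gcongr
  -- third term
  have hT3 : 2 ^ (t + 2) * U * Real.exp (-(C₁ * U)) ≤ 4 * 2 ^ t * K⁻¹ * E := by
    have h1 : Real.exp (-(C₁ * U)) = E * (Real.exp (-U) * Real.exp (-((t - 1 + Real.log K) * U))) := by
      rw [hE, ← Real.exp_add, ← Real.exp_add, hC₁]; congr 1; ring
    have h2 : U * Real.exp (-U) ≤ 1 := by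
      calc U * Real.exp (-U) ≤ Real.exp U * Real.exp (-U) := by gcongr
        _ = 1 := by rw [← Real.exp_add, add_neg_cancel, Real.exp_zero]
    have h3 : Real.exp (-((t - 1 + Real.log K) * U)) ≤ K⁻¹ := by
      rw [hKinv, Real.exp_le_exp]
      have ht1 : (1 : ℝ) ≤ t := by exact_mod_cast ht
      nlinarith
    calc 2 ^ (t + 2) * U * Real.exp (-(C₁ * U))
        = 4 * 2 ^ t * (U * Real.exp (-U)) * Real.exp (-((t - 1 + Real.log K) * U)) * E := by rw [h1]; ring
      _ ≤ 4 * 2 ^ t * 1 * K⁻¹ * E := by gcongr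
      _ = 4 * 2 ^ t * K⁻¹ * E := by ring
  -- sum: `(2/η + 4) 4^t ≤ K`
  have hsum : 2 ^ t / η * K⁻¹ * E + 2 ^ t / η * K⁻¹ * E + 4 * 2 ^ t * K⁻¹ * E ≤ E / 2 ^ t := by
    have hcoef : (2 / η + 4) * 2 ^ t * 2 ^ t ≤ K := by
      have hP : (0 : ℝ) < 2 ^ t * 2 ^ t := by positivity
      have hη' : (0 : ℝ) ≤ η⁻¹ := inv_nonneg.mpr hη.le
      rw [hK, div_eq_mul_inv]
      nlinarith
    calc 2 ^ t / η * K⁻¹ * E + 2 ^ t / η * K⁻¹ * E + 4 * 2 ^ t * K⁻¹ * E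
        = ((2 / η + 4) * 2 ^ t * 2 ^ t) * (K⁻¹ * E / 2 ^ t) := by field_simp; ring
      _ ≤ K * (K⁻¹ * E / 2 ^ t) := by gcongr
      _ = E / 2 ^ t := by field_simp
  linarith [hT1, hT2, hT3, hsum]

/-- **Stub `stub_ghostFreeAlong` (M–L; pure Walsh inversion).**  Law + singles + mixed ⟹ the ghost-free law:
for `N` with `N^{1/U} ≥ 2L + 2` every rough value has `1 ≤ Ω ≤ U`, so
`Σ_{j ∈ [1,U]^t} (∏_{i∈S}(-1)^{j_i}) C_j = siftedLiouvilleCorr … S` EXACTLY, while on the law's side the same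
twisted sum is `±MS θ_S Â^t` up to `2^{t+1} MS |Ã| Â^{t-1}` and the summed law error `U^t N (log N)^{-t-δ}`
(`Â = Σ_m A_m/N ≥ 1/(2 log N)` by `AnatomyAlong`, `Ã = Σ_m (-1)^m A_m/N` = the singles input at `t = 1` for the
identity form on `[-N, N]`); dividing by `MS Â^t ≥ ηN (2 log N)^{-t}` and feeding the singles/mixed inputs at
`C₁ = C + t + log(12·4^t(1 + 1/η))` gives `|θ_S| ≤ e^{-CU} 2^{-t}` for `S ≠ ∅`, hence `|Θ_θ(j) − 1| ≤ e^{-CU}`. -/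
theorem stub_ghostFreeAlong :
    CellParityLawSaving → SiftedSinglesAlong → SiftedChowlaMixedAlong → GhostFreeLawAlong := by
  intro hLaw h1 h2 t L ht η hη C
  have hLaw' : AbsoluteUpgrade.DipMarginRateExchange.CellParityLawSaving := hLaw
  obtain ⟨δ, hδ, N_L, hL⟩ := hLaw' t L ht
  -- the constants and the thresholds
  obtain ⟨Kc, hKc⟩ : ∃ Kc : ℝ, Kc = 12 * 2 ^ t * 2 ^ t * (1 + η⁻¹) := ⟨_, rfl⟩
  obtain ⟨C₁, hC₁⟩ : ∃ C₁ : ℝ, C₁ = C + t + Real.log Kc := ⟨_, rfl⟩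
  have hlogK : 0 ≤ Real.log Kc := Real.log_nonneg (by linarith [hKc ▸ twelve_le_K (t := t) hη])
  obtain ⟨N₁, hN₁⟩ := h1 t L ht C₁
  obtain ⟨N₂, hN₂⟩ := h2 t L ht C₁
  obtain ⟨N₃, hN₃⟩ := h1 1 1 le_rfl C₁
  obtain ⟨N_A, hNA⟩ := stub_anatomyAlong
  obtain ⟨N_Q, hNQ⟩ := quantClip_schedule (max (L + 1) (⌈(Real.log Kc + |(t : ℝ) + C|) / (4 * δ)⌉₊ + 1))
  refine ⟨δ, hδ, max N_L (max N₁ (max N₂ (max N₃ (max N_A N_Q)))), fun N hN Ψ hΨ hΨL K hK hKN hMS j hj => ?_⟩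
  simp only [max_le_iff] at hN
  obtain ⟨hNL, hN1, hN2, hN3, hNA', hNQ'⟩ := hN
  -- everything at the scale `N`
  obtain ⟨hU₀U, hN16, hexpU, -⟩ := hNQ N hNQ'
  have hU4 : 4 ≤ slowDegree N := four_le_slowDegree N
  have hA1 := hNA N hNA' 1 le_rfl (by omega)
  have hidL : affLinSize idForm N ≤ ((1 : ℕ) : ℝ) := by rw [(idForm_props (N : ℝ)).2.2]; simp
  have hcorr1 := hN₃ N hN3 idForm (idForm_props (N : ℝ)).1 hidL (realBox 1 N) (convex_Icc _ _) subset_rfl 0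
  have hsing := hN₁ N hN1 Ψ hΨ hΨL K hK hKN
  have hmix := hN₂ N hN2 Ψ hΨ hΨL K hK hKN
  obtain ⟨θ, hθ0, hθ2, hθlaw⟩ := hL N hNL Ψ hΨ hΨL K hK hKN
  clear hN₁ hN₂ hN₃ hNA hNQ hL
  set U : ℕ := slowDegree N with hUdef
  clear_value U
  simp only [max_le_iff] at hU₀U
  obtain ⟨hUL, hUΓ⟩ := hU₀U
  -- positivity
  have hU1nat : 1 ≤ U := by omega
  have hU1 : (1 : ℝ) ≤ U := by exact_mod_cast hU1nat
  have hU0 : (0 : ℝ) < U := by linarith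
  have hNnat : 1 ≤ N := by omega
  have hN0 : (0 : ℝ) < N := by exact_mod_cast (by omega : 0 < N)
  have hlN : 0 < Real.log N := lt_of_lt_of_le (Real.exp_pos _) hexpU
  have hMS0 : 0 < archFactor Ψ K * singularProduct Ψ := lt_of_lt_of_le (mul_pos hη hN0) hMS
  -- the sieving limit `N^{1/U} ≥ 4L + 5`
  have hz : (4 * L + 5 : ℝ) ≤ (N : ℝ) ^ ((1 : ℝ) / U) := by
    rw [Real.rpow_def_of_pos hN0, show Real.log N * (1 / U) = Real.log N / U by ring]
    have h2 : (4 * U : ℝ) ≤ Real.log N / U := by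
      rw [le_div_iff₀ hU0]; nlinarith [Real.add_one_le_exp (4 * (U : ℝ) ^ 2)]
    have h3 : (L : ℝ) + 1 ≤ U := by exact_mod_cast hUL
    linarith [Real.add_one_le_exp (Real.log N / U)]
  have hL0 : (0 : ℝ) ≤ L := Nat.cast_nonneg L
  have hz2 : (2 : ℝ) ≤ (N : ℝ) ^ ((1 : ℝ) / U) := by linarith
  have hzL : (2 * L : ℝ) ≤ (N : ℝ) ^ ((1 : ℝ) / U) := by linarith
  -- the normalised model cells `a_m = A_m(N)/N`; `Â ≥ a_1 ≥ 1/(2 log N)` (anatomy at `m = 1`)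
  set a : ℕ → ℝ := fun m => (cell U N m : ℝ) / N with ha
  have ha0 : ∀ m, 0 ≤ a m := fun m => by rw [ha]; positivity
  have hAp : 1 / (2 * Real.log N) ≤ ∑ m ∈ Icc 1 U, a m := by
    have hcd : cellDensity (1 - 1) (U : ℝ) = 1 := by rw [Nat.sub_self]; exact cellDensity_zero _
    rw [hcd, mul_one] at hA1
    have he : Real.exp (-((U : ℝ) ^ 2)) ≤ 1 := Real.exp_le_one_iff.mpr (by nlinarith)
    have h1' : (1 : ℝ) / 2 ≤ (cell U N 1 : ℝ) * Real.log N / N := by linarith [(abs_sub_le_iff.mp hA1).2]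
    calc 1 / (2 * Real.log N) ≤ a 1 := by
          rw [ha]; dsimp only
          rw [div_le_div_iff₀ (by positivity) hN0]
          rw [le_div_iff₀ hN0] at h1'
          nlinarith
      _ ≤ ∑ m ∈ Icc 1 U, a m := single_le_sum (fun m _ => ha0 m) (mem_Icc.mpr ⟨le_rfl, hU1nat⟩)
  have hAp0 : 0 < ∑ m ∈ Icc 1 U, a m := lt_of_lt_of_le (by positivity) hAp
  -- `|Ã| ≤ e^{-C₁U} U/log N` (singles at `t = 1` for the identity form)
  have hAm : |∑ m ∈ Icc 1 U, (-1 : ℝ) ^ m * a m| ≤ Real.exp (-(C₁ * U)) * U / Real.log N := by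
    have hsum : ∑ m ∈ Icc 1 U, (-1 : ℝ) ^ m * a m = (siftedLiouvilleCorr 1 N U idForm (realBox 1 N) {0} : ℝ) / N := by
      rw [← altSum_cell_eq_corr hNnat hU1nat hz2, sum_div]
      exact sum_congr rfl fun m _ => by rw [ha]; ring
    rw [hsum, abs_div, abs_of_pos hN0, div_le_div_iff₀ hN0 hlN]
    rw [pow_one, pow_one, le_div_iff₀ hlN] at hcorr1
    linarith
  -- the law at `N`, on the box
  have hlaw : ∀ j' ∈ Fintype.piFinset (fun _ : Fin t => Icc 1 U),
      |(jointCell t N U Ψ K j' : ℝ) - walshForm θ j' * (archFactor Ψ K * singularProduct Ψ * ∏ k, a (j' k))| ≤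
        N / (Real.log N ^ t * Real.log N ^ δ) :=
    fun j' hj' => hθlaw j' fun i => mem_Icc.mp (Fintype.mem_piFinset.mp hj' i)
  -- numerics inputs
  have hKU : Real.log Kc + ((t : ℝ) + C) * U ≤ 4 * δ * (U : ℝ) ^ 2 := by
    have h1' : (Real.log Kc + |(t : ℝ) + C|) / (4 * δ) ≤ U := by
      have h' : (⌈(Real.log Kc + |(t : ℝ) + C|) / (4 * δ)⌉₊ : ℝ) + 1 ≤ U := by exact_mod_cast hUΓ
      linarith [Nat.le_ceil ((Real.log Kc + |(t : ℝ) + C|) / (4 * δ))]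
    rw [div_le_iff₀ (by positivity)] at h1'
    have h2' : ((t : ℝ) + C) * U ≤ |(t : ℝ) + C| * U := mul_le_mul_of_nonneg_right (le_abs_self _) hU0.le
    nlinarith [mul_le_mul_of_nonneg_right h1' hU0.le, mul_nonneg hlogK (sub_nonneg.mpr hU1)]
  have hD : Real.exp (4 * δ * (U : ℝ) ^ 2) ≤ Real.log N ^ δ := by
    have := Real.rpow_le_rpow (Real.exp_pos _).le hexpU hδ.le
    rwa [← Real.exp_mul, show 4 * (U : ℝ) ^ 2 * δ = 4 * δ * (U : ℝ) ^ 2 by ring] at this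
  -- every amplitude `θ_S`, `S ≠ ∅`, is small
  have hθS : ∀ S : Finset (Fin t), S ≠ ∅ → |θ S| ≤ Real.exp (-(C * U)) / 2 ^ t := by
    intro S hS
    have hX : |∑ j' ∈ Fintype.piFinset (fun _ : Fin t => Icc 1 U), (∏ k ∈ S, (-1 : ℝ) ^ (j' k)) * (jointCell t N U Ψ K j' : ℝ)| ≤
        Real.exp (-(C₁ * U)) * N * (U : ℝ) ^ t / Real.log N ^ t := by
      rw [sum_sign_jointCell_eq_corr Ψ K hNnat hU1nat hΨL hz2 hzL S]
      by_cases h1c : S.card = 1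
      · obtain ⟨i', rfl⟩ := card_eq_one.mp h1c
        exact hsing i'
      · exact hmix S (by have := card_pos.mpr (nonempty_iff_ne_empty.mpr hS); omega)
    have hθ1 := abs_theta_le θ hθ2 (fun j' => (jointCell t N U Ψ K j' : ℝ)) hMS0 a ha0 hAp0 ⟨0, ht⟩ S hlaw hX
    have hθ2' := theta_bound_arith hη hN0 hlN (Real.rpow_pos_of_pos hlN δ) (Real.exp_pos _).le hU0.le hMS hAp hAm hθ1
    linarith [numerics ht hη hU1 hKc hC₁ hKU hD]
  -- the Walsh factor at `j` and the conclusion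
  have hW : |walshForm θ j - 1| ≤ Real.exp (-(C * U)) := abs_walshForm_sub_one_le θ hθ0 (Real.exp_pos _).le hθS j
  have hP : 0 ≤ archFactor Ψ K * singularProduct Ψ * ∏ i, a (j i) := mul_nonneg hMS0.le (prod_nonneg fun i _ => ha0 _)
  show |(jointCell t N U Ψ K j : ℝ) - archFactor Ψ K * singularProduct Ψ * ∏ i, a (j i)| ≤
    Real.exp (-(C * U)) * (archFactor Ψ K * singularProduct Ψ * ∏ i, a (j i)) + N / (Real.log N ^ t * Real.log N ^ δ)
  calc |(jointCell t N U Ψ K j : ℝ) - archFactor Ψ K * singularProduct Ψ * ∏ i, a (j i)|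
      = |((jointCell t N U Ψ K j : ℝ) - walshForm θ j * (archFactor Ψ K * singularProduct Ψ * ∏ i, a (j i))) +
          (walshForm θ j - 1) * (archFactor Ψ K * singularProduct Ψ * ∏ i, a (j i))| := by ring_nf
    _ ≤ |(jointCell t N U Ψ K j : ℝ) - walshForm θ j * (archFactor Ψ K * singularProduct Ψ * ∏ i, a (j i))| +
          |(walshForm θ j - 1) * (archFactor Ψ K * singularProduct Ψ * ∏ i, a (j i))| := abs_add_le _ _
    _ ≤ N / (Real.log N ^ t * Real.log N ^ δ) + Real.exp (-(C * U)) * (archFactor Ψ K * singularProduct Ψ * ∏ i, a (j i)) :=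
        add_le_add (hlaw j hj) (by rw [abs_mul, abs_of_nonneg hP]; exact mul_le_mul_of_nonneg_right hW hP)
    _ = _ := add_comm _ _

end Summit.Parity.GeneralizedHardyLittlewood.Cruxes.FibreHyperbolicityAlong.SiftedChowlaDistillation

end
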